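import Summits.ResolutionOfSingularities.ResolutionOfSingularities.Theorems.FrameStep1

/-!
# FrameStep (slice 2/4: frames and local subrings of a field)

Continuation of `Theorems.FrameStep1` ((M-Dict) TOOL of the `decomp-res` cell, lens-5 g39, toward
`TightDefectClasses.TowerDictionary`; see the module docstring of `Theorems.FrameStep1` for the architecture).

This slice: the local ring `B(θ) ⊆ L` of an injective frame `θ : K[Z,u] →ₐ[K] L` (fractions `θ a/θ s`,
`s(0) ≠ 0`), the origin ideal; the maximal ideal / units of a local subring `B' ⊆ L` read in `L`
(`maxSet`, `unitSet`); evaluation modulo `𝔪_{B'}` (`eval_mem_and_congr`: a frame centred in `B'` maps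
`K[Z,u]` into `B'`, `P ↦ unit` iff `P(0) ≠ 0`); `B(φ) ≤ B'` and `B' ≤ B(φ)` from a fraction certificate;
order contraction `φ P ∈ 𝔪_{B(φ)}^n ⇒ P ∈ 𝔫^n` (`𝔫^n` is `𝔫`-primary).
-/

set_option linter.dupNamespace false

open MvPolynomial
open Literature.AlgebraicGeometry.Resolution
open Literature.AlgebraicGeometry.Resolution.Hauser2010
open Literature.AlgebraicGeometry.Resolution.PointBlowup

namespace Summit.ResolutionOfSingularities.ResolutionOfSingularities.Theorems.FrameStep

noncomputable section

variable {σ : Type} [Fintype σ] [DecidableEq σ] {K : Type} [Field K]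

/-! ## §2 Frames: `K[Z,u]_{(Z,u)}` inside a field; local subrings; evaluation modulo the maximal ideal -/

section Frames

variable {L : Type} [Field L] [Algebra K L]

omit [Fintype σ] [DecidableEq σ] in
/-- An injective frame sends polynomials outside `𝔫` to non-zero elements. -/
theorem isUnit_map_of_not_mem (θ : MvPolynomial (Option σ) K →ₐ[K] L) (hθ : Function.Injective θ)
    {s : MvPolynomial (Option σ) K} (hs : s ∉ idealOfVars (Option σ) K) : IsUnit (θ s) :=
  isUnit_iff_ne_zero.mpr fun h => hs (by
    rw [(injective_iff_map_eq_zero θ).mp hθ s h]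
    exact Submodule.zero_mem _)

omit [Fintype σ] [DecidableEq σ] in
/-- Polynomials with non-zero constant term are closed under multiplication. -/
theorem mul_not_mem_idealOfVars {τ : Type} {s s' : MvPolynomial τ K} (hs : s ∉ idealOfVars τ K)
    (hs' : s' ∉ idealOfVars τ K) : s * s' ∉ idealOfVars τ K := by
  rw [mem_idealOfVars_iff] at hs hs' ⊢
  rw [map_mul]
  exact mul_ne_zero hs hs'

omit [Fintype σ] [DecidableEq σ] in
/-- `1 ∉ 𝔫`. -/
theorem one_not_mem_idealOfVars {τ : Type} : (1 : MvPolynomial τ K) ∉ idealOfVars τ K := by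
  rw [mem_idealOfVars_iff, map_one]
  exact one_ne_zero

/-- The local ring `B(θ) = θ(K[Z,u]_{(Z,u)}) ⊆ L` of an injective frame: the fractions `θ a / θ s` with
`s(0) ≠ 0`.  DEFINITION (support). -/
def frameRing (θ : MvPolynomial (Option σ) K →ₐ[K] L) (hθ : Function.Injective θ) : Subring L where
  carrier := {x | ∃ a s : MvPolynomial (Option σ) K, s ∉ idealOfVars (Option σ) K ∧ x = θ a / θ s}
  mul_mem' := by
    rintro x y ⟨a, s, hs, rfl⟩ ⟨a', s', hs', rfl⟩
    exact ⟨a * a', s * s', mul_not_mem_idealOfVars hs hs', by rw [map_mul, map_mul, div_mul_div_comm]⟩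
  one_mem' := ⟨1, 1, one_not_mem_idealOfVars, by rw [map_one, div_one]⟩
  add_mem' := by
    rintro x y ⟨a, s, hs, rfl⟩ ⟨a', s', hs', rfl⟩
    refine ⟨a * s' + s * a', s * s', mul_not_mem_idealOfVars hs hs', ?_⟩
    rw [div_add_div _ _ (isUnit_map_of_not_mem θ hθ hs).ne_zero (isUnit_map_of_not_mem θ hθ hs').ne_zero,
      map_add, map_mul, map_mul, map_mul]
  zero_mem' := ⟨0, 1, one_not_mem_idealOfVars, by rw [map_zero, zero_div]⟩
  neg_mem' := by
    rintro x ⟨a, s, hs, rfl⟩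
    exact ⟨-a, s, hs, by rw [map_neg, neg_div]⟩

omit [Fintype σ] [DecidableEq σ] in
/-- Membership in `B(θ)`: fractions `θ a / θ s` with `s ∉ 𝔫`. -/
theorem mem_frameRing_iff (θ : MvPolynomial (Option σ) K →ₐ[K] L) (hθ : Function.Injective θ) {x : L} :
    x ∈ frameRing θ hθ ↔ ∃ a s : MvPolynomial (Option σ) K, s ∉ idealOfVars (Option σ) K ∧ x = θ a / θ s :=
  Iff.rfl

omit [Fintype σ] [DecidableEq σ] in
/-- `θ(K[Z,u]) ⊆ B(θ)`. -/
theorem map_mem_frameRing (θ : MvPolynomial (Option σ) K →ₐ[K] L) (hθ : Function.Injective θ)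
    (a : MvPolynomial (Option σ) K) : θ a ∈ frameRing θ hθ :=
  ⟨a, 1, one_not_mem_idealOfVars, by rw [map_one, div_one]⟩

omit [Fintype σ] [DecidableEq σ] in
/-- `K ⊆ B(θ)`. -/
theorem algebraMap_mem_frameRing (θ : MvPolynomial (Option σ) K →ₐ[K] L) (hθ : Function.Injective θ) (c : K) :
    algebraMap K L c ∈ frameRing θ hθ := by
  rw [← θ.commutes c]
  exact map_mem_frameRing θ hθ _

/-- The ideal `(θ Z, θ u) ⊆ B(θ)` of the origin.  DEFINITION (support). -/
def originIdeal (θ : MvPolynomial (Option σ) K →ₐ[K] L) (hθ : Function.Injective θ) : Ideal (frameRing θ hθ) :=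
  Ideal.span (Set.range fun o : Option σ => (⟨θ (X o), map_mem_frameRing θ hθ (X o)⟩ : frameRing θ hθ))

/-! ### Local subrings of a field: the maximal ideal and the units, read in the field -/

variable (B' : Subring L)

/-- The maximal ideal of the local subring `B' ⊆ L`, read as a subset of `L`.  DEFINITION (support). -/
def maxSet [IsLocalRing B'] : Set L := {x | ∃ h : x ∈ B', (⟨x, h⟩ : B') ∈ IsLocalRing.maximalIdeal B'}

/-- The units of the subring `B' ⊆ L`, read as a subset of `L`.  DEFINITION (support). -/
def unitSet : Set L := {x | ∃ h : x ∈ B', IsUnit (⟨x, h⟩ : B')}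

variable {B'}

/-- Units of `B'` read in `L`: `x, x⁻¹ ∈ B'`. -/
theorem mem_unitSet_iff {x : L} : x ∈ unitSet B' ↔ x ∈ B' ∧ x⁻¹ ∈ B' ∧ x ≠ 0 := by
  constructor
  · rintro ⟨hx, u, hu⟩
    have hx0 : x ≠ 0 := by
      rintro rfl
      have h0 : (⟨0, hx⟩ : B') = 0 := Subtype.ext rfl
      exact not_isUnit_zero (h0 ▸ ⟨u, hu⟩ : IsUnit (0 : B'))
    refine ⟨hx, ?_, hx0⟩
    have h1 : ((u⁻¹ : B'ˣ) : B') * ⟨x, hx⟩ = 1 := by rw [← hu, Units.inv_mul]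
    have h2 : (((u⁻¹ : B'ˣ) : B') : L) * x = 1 := by
      have := congrArg Subtype.val h1
      simpa using this
    rw [inv_eq_of_mul_eq_one_left h2]
    exact SetLike.coe_mem _
  · rintro ⟨hx, hinv, hx0⟩
    exact ⟨hx, IsUnit.of_mul_eq_one ⟨x⁻¹, hinv⟩ (Subtype.ext (mul_inv_cancel₀ hx0))⟩

/-- A unit is not in the maximal ideal. -/
theorem not_mem_maxSet_of_mem_unitSet [IsLocalRing B'] {x : L} (h : x ∈ unitSet B') : x ∉ maxSet B' := by
  rintro ⟨hx, hm⟩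
  obtain ⟨hx', hu⟩ := h
  exact (IsLocalRing.mem_maximalIdeal (⟨x, hx⟩ : B')).mp hm hu

/-- Dichotomy in a local ring: an element of `B'` is in the maximal ideal or a unit. -/
theorem mem_maxSet_or_mem_unitSet [IsLocalRing B'] {x : L} (hx : x ∈ B') : x ∈ maxSet B' ∨ x ∈ unitSet B' := by
  by_cases hu : IsUnit (⟨x, hx⟩ : B')
  · exact Or.inr ⟨hx, hu⟩
  · exact Or.inl ⟨hx, (IsLocalRing.mem_maximalIdeal _).mpr hu⟩

/-- `0 ∈ 𝔪_{B'}`. -/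
theorem zero_mem_maxSet [IsLocalRing B'] : (0 : L) ∈ maxSet B' :=
  ⟨zero_mem B', (IsLocalRing.maximalIdeal B').zero_mem⟩

/-- `𝔪_{B'}` is closed under addition. -/
theorem add_mem_maxSet [IsLocalRing B'] {x y : L} (hx : x ∈ maxSet B') (hy : y ∈ maxSet B') :
    x + y ∈ maxSet B' := by
  obtain ⟨hx, hmx⟩ := hx
  obtain ⟨hy, hmy⟩ := hy
  exact ⟨add_mem hx hy, Ideal.add_mem _ hmx hmy⟩

/-- `𝔪_{B'}` is closed under negation. -/
theorem neg_mem_maxSet [IsLocalRing B'] {x : L} (hx : x ∈ maxSet B') : -x ∈ maxSet B' := by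
  obtain ⟨hx, hmx⟩ := hx
  exact ⟨neg_mem hx, (IsLocalRing.maximalIdeal B').neg_mem hmx⟩

/-- `𝔪_{B'}` is closed under subtraction. -/
theorem sub_mem_maxSet [IsLocalRing B'] {x y : L} (hx : x ∈ maxSet B') (hy : y ∈ maxSet B') :
    x - y ∈ maxSet B' := by
  rw [sub_eq_add_neg]
  exact add_mem_maxSet hx (neg_mem_maxSet hy)

/-- `𝔪_{B'}` absorbs multiplication by `B'` on the left. -/
theorem mul_mem_maxSet_left [IsLocalRing B'] {x y : L} (hy : y ∈ B') (hx : x ∈ maxSet B') : y * x ∈ maxSet B' := by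
  obtain ⟨hx, hm⟩ := hx
  exact ⟨mul_mem hy hx, Ideal.mul_mem_left _ ⟨y, hy⟩ hm⟩

/-- `𝔪_{B'}` absorbs multiplication by `B'` on the right. -/
theorem mul_mem_maxSet_right [IsLocalRing B'] {x y : L} (hy : y ∈ B') (hx : x ∈ maxSet B') :
    x * y ∈ maxSet B' := by
  rw [mul_comm]
  exact mul_mem_maxSet_left hy hx

/-- `𝔪_{B'}` is radical: `x^n ∈ 𝔪 ⇒ x ∈ 𝔪`. -/
theorem mem_maxSet_of_pow_mem [IsLocalRing B'] {x : L} {n : ℕ} (hx : x ∈ B') (h : x ^ n ∈ maxSet B') :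
    x ∈ maxSet B' := by
  obtain ⟨hxn, hm⟩ := h
  refine ⟨hx, (IsLocalRing.maximalIdeal.isMaximal B').isPrime.mem_of_pow_mem n ?_⟩
  have he : (⟨x, hx⟩ : B') ^ n = ⟨x ^ n, hxn⟩ := Subtype.ext (by simp)
  rw [he]
  exact hm

/-- A finite sum of elements of `𝔪_{B'}` is in `𝔪_{B'}`. -/
theorem sum_mem_maxSet [IsLocalRing B'] {ι : Type} (s : Finset ι) (f : ι → L) (h : ∀ i ∈ s, f i ∈ maxSet B') :
    ∑ i ∈ s, f i ∈ maxSet B' := by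
  classical
  induction s using Finset.induction_on with
  | empty => simpa using (zero_mem_maxSet (B' := B'))
  | insert a s ha ih =>
    rw [Finset.sum_insert ha]
    exact add_mem_maxSet (h a (Finset.mem_insert_self a s)) (ih fun i hi => h i (Finset.mem_insert_of_mem hi))

/-- `1 ∉ 𝔪_{B'}`. -/
theorem one_not_mem_maxSet [IsLocalRing B'] : (1 : L) ∉ maxSet B' := by
  rintro ⟨h1, hm⟩
  have he : (⟨1, h1⟩ : B') = 1 := Subtype.ext rfl
  rw [he] at hm
  exact (IsLocalRing.maximalIdeal.isMaximal B').ne_top ((Ideal.eq_top_iff_one _).mpr hm)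

/-- Units of `B'` are closed under multiplication. -/
theorem mul_mem_unitSet {x y : L} (hx : x ∈ unitSet B') (hy : y ∈ unitSet B') : x * y ∈ unitSet B' := by
  obtain ⟨hx, hux⟩ := hx
  obtain ⟨hy, huy⟩ := hy
  refine ⟨mul_mem hx hy, ?_⟩
  have he : (⟨x * y, mul_mem hx hy⟩ : B') = ⟨x, hx⟩ * ⟨y, hy⟩ := Subtype.ext rfl
  rw [he]
  exact hux.mul huy

/-- Units of `B'` are closed under powers. -/
theorem pow_mem_unitSet {x : L} (n : ℕ) (hx : x ∈ unitSet B') : x ^ n ∈ unitSet B' := by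
  obtain ⟨hx, hux⟩ := hx
  refine ⟨pow_mem hx n, ?_⟩
  have he : (⟨x ^ n, pow_mem hx n⟩ : B') = ⟨x, hx⟩ ^ n := Subtype.ext (by simp)
  rw [he]
  exact hux.pow n

/-- Units of `B'` are closed under inversion (in `L`). -/
theorem inv_mem_unitSet {x : L} (h : x ∈ unitSet B') : x⁻¹ ∈ unitSet B' := by
  obtain ⟨hx, hinv, hx0⟩ := mem_unitSet_iff.mp h
  exact mem_unitSet_iff.mpr ⟨hinv, by rw [inv_inv]; exact hx, inv_ne_zero hx0⟩

/-- `1` is a unit of `B'`. -/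
theorem one_mem_unitSet : (1 : L) ∈ unitSet B' := by
  refine ⟨one_mem B', ?_⟩
  have he : (⟨1, one_mem B'⟩ : B') = 1 := Subtype.ext rfl
  rw [he]
  exact isUnit_one

/-- unit `+` element of `𝔪` is a unit. -/
theorem add_mem_unitSet_of_mem_maxSet [IsLocalRing B'] {x y : L} (hx : x ∈ unitSet B') (hy : y ∈ maxSet B') :
    x + y ∈ unitSet B' := by
  rcases mem_maxSet_or_mem_unitSet (B' := B') (add_mem hx.1 hy.1) with h | h
  · have hx' : x ∈ maxSet B' := by simpa using sub_mem_maxSet h hy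
    exact absurd hx' (not_mem_maxSet_of_mem_unitSet hx)
  · exact h

/-- Non-zero constants are units of `B'` (when `K ⊆ B'`). -/
theorem algebraMap_mem_unitSet (hK : ∀ c : K, algebraMap K L c ∈ B') {c : K} (hc : c ≠ 0) :
    algebraMap K L c ∈ unitSet B' :=
  mem_unitSet_iff.mpr ⟨hK c, by rw [← map_inv₀]; exact hK _, by simpa using hc⟩

/-- **Evaluation modulo the maximal ideal**: if `φ` sends the variables into `𝔪_{B'}` (and `K ⊆ B'`)
then `φ P ∈ B'` and `φ P ≡ P(0) (mod 𝔪_{B'})`. -/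
theorem eval_mem_and_congr [IsLocalRing B'] {τ : Type} (φ : MvPolynomial τ K →ₐ[K] L)
    (hK : ∀ c : K, algebraMap K L c ∈ B') (hφ : ∀ i, φ (X i) ∈ maxSet B') (P : MvPolynomial τ K) :
    φ P ∈ B' ∧ φ P - algebraMap K L (constantCoeff P) ∈ maxSet B' := by
  induction P using MvPolynomial.induction_on with
  | C c =>
    rw [algHom_C, constantCoeff_C, sub_self]
    exact ⟨hK c, zero_mem_maxSet⟩
  | add P Q hP hQ =>
    rw [map_add, map_add, map_add]
    refine ⟨add_mem hP.1 hQ.1, ?_⟩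
    have he : φ P + φ Q - (algebraMap K L (constantCoeff P) + algebraMap K L (constantCoeff Q))
        = (φ P - algebraMap K L (constantCoeff P)) + (φ Q - algebraMap K L (constantCoeff Q)) := by ring
    rw [he]
    exact add_mem_maxSet hP.2 hQ.2
  | mul_X P i hP =>
    rw [map_mul, map_mul, constantCoeff_X, mul_zero, map_zero, sub_zero]
    exact ⟨mul_mem hP.1 (hφ i).1, mul_mem_maxSet_left hP.1 (hφ i)⟩

/-- Polynomials without constant term evaluate into `𝔪_{B'}`. -/
theorem eval_mem_maxSet_of_mem [IsLocalRing B'] {τ : Type} (φ : MvPolynomial τ K →ₐ[K] L)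
    (hK : ∀ c : K, algebraMap K L c ∈ B') (hφ : ∀ i, φ (X i) ∈ maxSet B') {P : MvPolynomial τ K}
    (hP : P ∈ idealOfVars τ K) : φ P ∈ maxSet B' := by
  have h := (eval_mem_and_congr φ hK hφ P).2
  rwa [(mem_idealOfVars_iff P).mp hP, map_zero, sub_zero] at h

/-- Polynomials with non-zero constant term evaluate to units of `B'`. -/
theorem eval_mem_unitSet_of_not_mem [IsLocalRing B'] {τ : Type} (φ : MvPolynomial τ K →ₐ[K] L)
    (hK : ∀ c : K, algebraMap K L c ∈ B') (hφ : ∀ i, φ (X i) ∈ maxSet B') {P : MvPolynomial τ K}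
    (hP : P ∉ idealOfVars τ K) : φ P ∈ unitSet B' := by
  have h := eval_mem_and_congr φ hK hφ P
  have hu : algebraMap K L (constantCoeff P) ∈ unitSet B' :=
    algebraMap_mem_unitSet hK (constantCoeff_ne_zero_of_not_mem hP)
  have he : φ P = algebraMap K L (constantCoeff P) + (φ P - algebraMap K L (constantCoeff P)) := by ring
  rw [he]
  exact add_mem_unitSet_of_mem_maxSet hu h.2

/-- Conversely a polynomial evaluating to a unit of `B'` has non-zero constant term. -/
theorem not_mem_of_eval_mem_unitSet [IsLocalRing B'] {τ : Type} (φ : MvPolynomial τ K →ₐ[K] L)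
    (hK : ∀ c : K, algebraMap K L c ∈ B') (hφ : ∀ i, φ (X i) ∈ maxSet B') {P : MvPolynomial τ K}
    (hP : φ P ∈ unitSet B') : P ∉ idealOfVars τ K :=
  fun h => not_mem_maxSet_of_mem_unitSet hP (eval_mem_maxSet_of_mem φ hK hφ h)

/-! ### A frame centred in `B'`: `B(φ) ≤ B'`, and `B' ≤ B(φ)` from a fraction certificate -/

omit [Fintype σ] [DecidableEq σ] in
/-- If the frame's variables lie in `𝔪_{B'}` then `B(φ) ≤ B'`. -/
theorem frameRing_le [IsLocalRing B'] (φ : MvPolynomial (Option σ) K →ₐ[K] L) (hφi : Function.Injective φ)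
    (hK : ∀ c : K, algebraMap K L c ∈ B') (hφ : ∀ o, φ (X o) ∈ maxSet B') : frameRing φ hφi ≤ B' := by
  intro x hx
  obtain ⟨a, s, hs, rfl⟩ := (mem_frameRing_iff φ hφi).mp hx
  rw [div_eq_mul_inv]
  exact mul_mem (eval_mem_and_congr φ hK hφ a).1 (mem_unitSet_iff.mp (eval_mem_unitSet_of_not_mem φ hK hφ hs)).2.1

omit [Fintype σ] [DecidableEq σ] in
/-- … and then `B(φ)` is closed under division by units of `B'`. -/
theorem div_mem_frameRing [IsLocalRing B'] (φ : MvPolynomial (Option σ) K →ₐ[K] L) (hφi : Function.Injective φ)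
    (hK : ∀ c : K, algebraMap K L c ∈ B') (hφ : ∀ o, φ (X o) ∈ maxSet B') {x y : L}
    (hx : x ∈ frameRing φ hφi) (hy : y ∈ frameRing φ hφi) (hyu : y ∈ unitSet B') : x / y ∈ frameRing φ hφi := by
  obtain ⟨a, s, hs, rfl⟩ := (mem_frameRing_iff φ hφi).mp hx
  obtain ⟨a', s', hs', rfl⟩ := (mem_frameRing_iff φ hφi).mp hy
  have hs'0 : φ s' ≠ 0 := (isUnit_map_of_not_mem φ hφi hs').ne_zero
  have ha' : a' ∉ idealOfVars (Option σ) K := by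
    refine not_mem_of_eval_mem_unitSet φ hK hφ ?_
    have he : φ a' = φ a' / φ s' * φ s' := (div_mul_cancel₀ (φ a') hs'0).symm
    rw [he]
    exact mul_mem_unitSet hyu (eval_mem_unitSet_of_not_mem φ hK hφ hs')
  refine (mem_frameRing_iff φ hφi).mpr ⟨a * s', s * a', fun h => ?_, ?_⟩
  · exact ((idealOfVars_isMaximal (K := K) (τ := Option σ)).isPrime.mem_or_mem h).elim hs ha'
  · rw [div_div_div_eq, map_mul, map_mul]

omit [Fintype σ] [DecidableEq σ] in
/-- **`B' ≤ B(φ)` from a fraction certificate**: if every element of `B'` is a quotient of elements of a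
subring `C ≤ B(φ)` with denominator invertible in `B'`, then `B' ≤ B(φ)`. -/
theorem le_frameRing_of_frac [IsLocalRing B'] (φ : MvPolynomial (Option σ) K →ₐ[K] L)
    (hφi : Function.Injective φ) (hK : ∀ c : K, algebraMap K L c ∈ B') (hφ : ∀ o, φ (X o) ∈ maxSet B')
    (C : Subring L) (hC : C ≤ frameRing φ hφi)
    (hfrac : ∀ w ∈ B', ∃ y ∈ C, ∃ z ∈ C, z ≠ 0 ∧ z⁻¹ ∈ B' ∧ w = y / z) : B' ≤ frameRing φ hφi := by
  intro w hw
  obtain ⟨y, hy, z, hz, hz0, hzinv, rfl⟩ := hfrac w hw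
  exact div_mem_frameRing φ hφi hK hφ (hC hy) (hC hz)
    (mem_unitSet_iff.mpr ⟨frameRing_le φ hφi hK hφ (hC hz), hzinv, hz0⟩)

/-! ### Reading `𝔪_{B(φ)}^n` back in `K[Z,u]` -/

omit [Fintype σ] [DecidableEq σ] in
/-- **Order contraction**: if `B(φ) = B'` and `φ P ∈ 𝔪_{B'}^n` then `P ∈ 𝔫^n`
(`𝔪_{B(φ)}` is generated by `φ(𝔫)`, and `𝔫^n` is `𝔫`-primary). -/
theorem mem_pow_idealOfVars_of_mem_pow [IsLocalRing B'] (φ : MvPolynomial (Option σ) K →ₐ[K] L)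
    (hφi : Function.Injective φ) (hB : frameRing φ hφi = B') (n : ℕ) (P : MvPolynomial (Option σ) K)
    (h : ∃ hP : φ P ∈ B', (⟨φ P, hP⟩ : B') ∈ IsLocalRing.maximalIdeal B' ^ n) :
    P ∈ idealOfVars (Option σ) K ^ n := by
  subst hB
  obtain ⟨hP, h⟩ := h
  set 𝔫 := idealOfVars (Option σ) K
  set R := frameRing φ hφi
  let ι : MvPolynomial (Option σ) K →+* R := φ.toRingHom.codRestrict R (map_mem_frameRing φ hφi)
  have hι : ∀ a, ((ι a : R) : L) = φ a := fun a => rfl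
  -- the maximal ideal of `B(φ)` is generated by `φ(𝔫)`
  have hmax : IsLocalRing.maximalIdeal R ≤ Ideal.map ι 𝔫 := by
    intro x hx
    obtain ⟨a, s, hs, hxe⟩ := x.2
    by_cases ha : a ∈ 𝔫
    · have hw : (φ s)⁻¹ ∈ R := ⟨1, s, hs, by rw [map_one, one_div]⟩
      have hxw : x = ι a * ⟨(φ s)⁻¹, hw⟩ := Subtype.ext (by rw [Subring.coe_mul, hι, hxe, div_eq_mul_inv])
      rw [hxw]
      exact Ideal.mul_mem_right _ _ (Ideal.mem_map_of_mem ι ha)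
    · exfalso
      have hy : φ s / φ a ∈ R := ⟨s, a, ha, rfl⟩
      have ha0 : φ a ≠ 0 := (isUnit_map_of_not_mem φ hφi ha).ne_zero
      have hs0 : φ s ≠ 0 := (isUnit_map_of_not_mem φ hφi hs).ne_zero
      have hunit : IsUnit x := IsUnit.of_mul_eq_one ⟨φ s / φ a, hy⟩ (Subtype.ext (by
        rw [Subring.coe_mul, hxe, Subring.coe_one, div_mul_div_comm, mul_comm, div_self (mul_ne_zero hs0 ha0)]))
      exact (IsLocalRing.mem_maximalIdeal x).mp hx hunit
  -- elements of `ι(𝔫^n) · B(φ)` are fractions with numerator in `𝔫^n`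
  have key : ∀ x ∈ Ideal.map ι (𝔫 ^ n), ∃ a s, a ∈ 𝔫 ^ n ∧ s ∉ 𝔫 ∧ ((x : R) : L) = φ a / φ s := by
    intro x hx
    rw [Ideal.map] at hx
    induction hx using Submodule.span_induction with
    | mem x hx =>
      obtain ⟨a, ha, rfl⟩ := hx
      exact ⟨a, 1, ha, one_not_mem_idealOfVars, by rw [hι, map_one, div_one]⟩
    | zero => exact ⟨0, 1, Submodule.zero_mem _, one_not_mem_idealOfVars, by rw [map_zero, map_one, zero_div]; rfl⟩
    | add x y _ _ hx hy =>
      obtain ⟨a, s, ha, hs, hxe⟩ := hx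
      obtain ⟨a', s', ha', hs', hye⟩ := hy
      refine ⟨a * s' + s * a', s * s', ?_, mul_not_mem_idealOfVars hs hs', ?_⟩
      · exact Ideal.add_mem _ (Ideal.mul_mem_right _ _ ha) (Ideal.mul_mem_left _ _ ha')
      · rw [Subring.coe_add, hxe, hye, div_add_div _ _ (isUnit_map_of_not_mem φ hφi hs).ne_zero
          (isUnit_map_of_not_mem φ hφi hs').ne_zero, map_add, map_mul, map_mul, map_mul]
    | smul r x _ hx =>
      obtain ⟨a, s, ha, hs, hxe⟩ := hx
      obtain ⟨b, t, ht, hre⟩ := r.2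
      refine ⟨b * a, t * s, Ideal.mul_mem_left _ _ ha, mul_not_mem_idealOfVars ht hs, ?_⟩
      rw [smul_eq_mul, Subring.coe_mul, hxe, hre, map_mul, map_mul, div_mul_div_comm]
  have h' : (⟨φ P, hP⟩ : R) ∈ Ideal.map ι (𝔫 ^ n) := by
    rw [Ideal.map_pow]
    exact Ideal.pow_right_mono hmax n h
  obtain ⟨a, s, ha, hs, hPe⟩ := key _ h'
  have hs0 : φ s ≠ 0 := (isUnit_map_of_not_mem φ hφi hs).ne_zero
  have hPs : P * s = a := hφi (by rw [map_mul]; exact (eq_div_iff hs0).mp hPe)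
  by_cases hn : n = 0
  · subst hn; simp
  have hprim : (𝔫 ^ n).IsPrimary := Ideal.isPrimary_of_isMaximal_radical (by
    rw [Ideal.radical_pow _ hn, (idealOfVars_isMaximal (K := K) (τ := Option σ)).isPrime.radical]
    exact idealOfVars_isMaximal)
  rcases (Ideal.isPrimary_iff.mp hprim).2 (hPs ▸ ha : P * s ∈ 𝔫 ^ n) with hPn | hsn
  · exact hPn
  · exfalso
    rw [Ideal.radical_pow _ hn, (idealOfVars_isMaximal (K := K) (τ := Option σ)).isPrime.radical] at hsn
    exact hs hsn

end Frames

end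

end Summit.ResolutionOfSingularities.ResolutionOfSingularities.Theorems.FrameStep
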